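import Literature.NumberTheory.Automorphic.BCDTModularity
import Literature.NumberTheory.GaloisRepresentations.SerreCartanNormalizerGL2Fp
import HarnessLib

/-!
# Freitas–Le Hung–Siksek 2015, §5.3: the modular curve `X(s3,s5) ≅ X₀(225)/⟨w₉, w₂₅⟩` —
# canonical model, `j`-map, and the moduli statement (definitions + one named fact)

Topic `Literature/NumberTheory/Automorphic`; companion of `FLSResidualImageCriteria.lean`,
`FLSModFiveImageSqrtFive.lean`, `TotallyRealModularityQuarticSixteenCurves.lean` (same source,
same vocabulary: framings `WeierstrassCurve.IsTorsionGaloisRep`, Serre's `splitCartan`).  Typed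
for the cell `pub/lg-quartmod` (rung F-L1), route `Langlands/SqrtFiveQuarticCovers`, whose
certificate `CertS3H8` (sheets 4.4 `X(s3,H8,b7)`, 4.8 `X(s3,H8,e7)`; carrier `X(s3,H8)`, an étale
double cover over `ℚ(√5)` of the curve of this file) is reduced in
`Summits/Langlands/Langlands/Theorems/SqrtFiveQuarticCoversCertS3H8.lean` to the named fact below
plus ONE certified finite computation stated on the model below.  Nothing here proves modularity
of anything; no quadratic-point determination of the source is restated as a fact.

## What the source prints (held text `paper:arxiv-1310.7088` = arXiv:1310.7088, pp. 9, 26–27)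

N. Freitas, B. V. Le Hung, S. Siksek, *Elliptic curves over real quadratic fields are modular*,
Invent. Math. 201 (2015) 159–206 [FreitasLeHungSiksek2015].
* §2.2 (p. 9), for subgroups `Hᵢ ≤ GL₂(𝔽_{pᵢ})` with `−I ∈ Hᵢ`, `det Hᵢ = 𝔽_{pᵢ}ˣ`: "`X(H₁,…,H_r)`
  is naturally endowed with a `j`-map to `X(1)` … If `K` is a number field, non-cuspidal `K`-points
  correspond to (isomorphism classes of) pairs `(E, η∘∏Hᵢ)` of elliptic curves `E/K` with an
  `∏Hᵢ`-orbit of isomorphisms `η : ∏ 𝔽_{pᵢ}² ≅ E[∏pᵢ](ℚ̄)` such that `η⁻¹ ρ̄_{E,pᵢ}(G_K) η` is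
  contained in `Hᵢ`"; `X(s p)` is the curve of `C_s⁺(p)`, the normaliser of a split Cartan
  subgroup (§2.1).
* §5.3 "Real Quadratic Points on `X(s3,s5)`", proof of its Lemma (held text "Lemma 3.1", p. 26):
  "we use the canonical map to write down a model for `X ≅ X₀(225)/⟨w₉, w₂₅⟩` … Thus `X` has genus
  `4` … The canonical map `X → ℙ³` induced by `g₁,…,g₄` is an embedding and yields the following
  model: `3x₁² − x₂² − 2x₃² + 2x₃x₄ − 3x₄² = 0`, `x₂²x₃ − x₃³ + 4x₃²x₄ − 12x₃x₄² + 12x₄³ = 0`",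
  with `u = x₁x₃/x₄²`, `v = x₂x₃/x₄²`, `w = x₃/x₄` giving the affine model (s3s5)
  `u² = w(w−1)(w²−w+4)`, `v² = w(w³−4w²+12w−12)`; and (p. 27, eqn (js3s5)) "On the model (s3s5),
  the `j`-map is given by `j = (R₁ + R₂·v)³ / (8 R₃¹⁵)`" with the printed polynomials `R₁` (degree
  `15`), `R₂` (degree `13`) in `w` and `R₃ = w² − w − 1`; "The expression for `j` involves only `w`
  and `v`. Thus the map `j : X → X(1)` factors via `φ₂ : X → D₂`."

## Contents

* `FLS2015.s3s5Quadric`, `s3s5Cubic` — the two printed equations of the canonical model in `ℙ³`,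
  as forms over any commutative ring; `s3s5R₁`, `s3s5R₂` — the printed `R₁, R₂` HOMOGENISED in
  `(x₃, x₄)` (`x₄¹⁵ R₁(x₃/x₄)`, `x₄¹³ R₂(x₃/x₄)`); `s3s5JNum x₂ x₃ x₄ = (R₁ʰ + R₂ʰ·x₂x₃)³` and
  `s3s5JDen x₃ x₄ = 8 x₄¹⁵ (x₃² − x₃x₄ − x₄²)¹⁵`, so that `j = s3s5JNum / s3s5JDen` wherever
  `x₄ ≠ 0` and `w² − w − 1 ≠ 0` (substitute `v = x₂x₃/x₄²`, `w = x₃/x₄` in (js3s5) and clear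
  `x₄⁴⁵`).
* PROVED (kernel, section `ModelChecks`): the four rational points at `x₄ = 0`,
  `(±1 : ±1 : 1 : 0)`, and the eight `ℚ(√5)`-points over `w² = w + 1`,
  `(±2r : ±(5 − r) : 3 + r : 1 + r)` with `r² = 5`, lie on the model (`s3s5_point_at_infinity`,
  `s3s5_point_over_golden`); the printed numerator at `x₄ = 0` is `(1 + x₂)³` — zero at the two CM
  points `(±1 : −1 : 1 : 0)`, `8` at the two cusps (`s3s5JNum_infinity`); `R₁(0) = −132`, so
  `j = 66³` over the node (`s3s5JNum_node`); the locus `x₃ = x₄ = 0` is `3x₁² = x₂²`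
  (`s3s5Quadric_eq_zero_of_x₃_x₄`); where the printed denominator vanishes (`s3s5JDen_eq_zero_iff`).
* NAMED FACT (D-0014) `FLS2015.s3s5_jRelation_of_isTorsionGaloisRep` — the moduli statement of
  §2.2 for `X(s3,s5)` on the printed model with the printed `j`-map: an elliptic curve `E / K`
  (any number field) whose mod-`3` and mod-`5` representations have image, in some framings, in the
  normaliser of a split Cartan subgroup gives a `K`-point `x ≠ 0` of the model with
  `j(E)·JDen(x) = JNum(x)`, i.e. `c₄³·JDen = JNum·Δ`; at the fourteen points where `JDen` vanishes
  the relation is completed by the VALUE of the regular extension of the printed map at its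
  non-cuspidal members: `j = −2¹⁵ = −32768` at `(±1 : −1 : 1 : 0)` and at the four points over
  `w² = w + 1` with `v = +(5 − r)/2` (CM by `ℤ[(1+√−11)/2]`), `j = 66³ = 287496` at
  `(1 : ±√3 : 0 : 0)` (the place over the node `w = 0` of (s3s5), `j = R₁(0)³/(−8)`); the other
  six are cusps.  These two values are an exact evaluation of the printed formula (power series to
  order `5` along `v² = h₂(w)`; done independently three times in the cell: eng-9 kit j313249,
  eng-3 E9-RESULT §1(c), typ-1 scratch/check2.py) — the source itself only says that the points of
  its case (a) "are cusps", which is true for four of the eight points over `w² = w + 1`.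

## What is NOT here

The source's Lemma itself (all non-cuspidal REAL QUADRATIC points of `X(s3,s5)` are modular), its
quotients `D₁ ≅ 15A8`, `D₂ ≅ 225A1`, `D₃` and `J(D₃)(ℚ) = ℤ/10`, and any point COUNT — the
cell's census over `ℚ(√5)` is a certified computation consumed Summits-side as an explicit
hypothesis, not a Literature fact.
-/

open scoped NumberField MatrixGroups
open NumberField Field Matrix Literature.NumberTheory.GaloisRepresentations

noncomputable section

namespace Literature.NumberTheory.Automorphic

namespace FLS2015

section Model

variable {R : Type*} [CommRing R]

/-- The quadric `3x₁² − x₂² − 2x₃² + 2x₃x₄ − 3x₄²` of the canonical model of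
`X(s3,s5) ≅ X₀(225)/⟨w₉,w₂₅⟩` in `ℙ³`.
[cite: FreitasLeHungSiksek2015, §5.3, proof of the Lemma on X(s3,s5) (arXiv:1310.7088 p. 26)] -/
def s3s5Quadric (x₁ x₂ x₃ x₄ : R) : R :=
  3 * x₁ ^ 2 - x₂ ^ 2 - 2 * x₃ ^ 2 + 2 * x₃ * x₄ - 3 * x₄ ^ 2

/-- The cubic `x₂²x₃ − x₃³ + 4x₃²x₄ − 12x₃x₄² + 12x₄³` of the canonical model of `X(s3,s5)` in
`ℙ³`. [cite: FreitasLeHungSiksek2015, §5.3, proof of the Lemma on X(s3,s5) (arXiv:1310.7088 p. 26)] -/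
def s3s5Cubic (_x₁ x₂ x₃ x₄ : R) : R :=
  x₂ ^ 2 * x₃ - x₃ ^ 3 + 4 * x₃ ^ 2 * x₄ - 12 * x₃ * x₄ ^ 2 + 12 * x₄ ^ 3

/-- The printed polynomial `R₁(w)` of the `j`-map (js3s5), `w = x₃/x₄`, homogenised:
`x₄¹⁵ · R₁(x₃/x₄)`. [cite: FreitasLeHungSiksek2015, §5.3, eqn (js3s5) (arXiv:1310.7088 p. 27)] -/
def s3s5R₁ (x₃ x₄ : R) : R :=
  x₃ ^ 15 - 10 * x₃ ^ 14 * x₄ + 45 * x₃ ^ 13 * x₄ ^ 2 - 115 * x₃ ^ 12 * x₄ ^ 3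
    + 155 * x₃ ^ 11 * x₄ ^ 4 - 54 * x₃ ^ 10 * x₄ ^ 5 + 185 * x₃ ^ 9 * x₄ ^ 6
    - 2395 * x₃ ^ 8 * x₄ ^ 7 + 10465 * x₃ ^ 7 * x₄ ^ 8 - 27055 * x₃ ^ 6 * x₄ ^ 9
    + 47072 * x₃ ^ 5 * x₄ ^ 10 - 56090 * x₃ ^ 4 * x₄ ^ 11 + 43405 * x₃ ^ 3 * x₄ ^ 12
    - 19485 * x₃ ^ 2 * x₄ ^ 13 + 4020 * x₃ * x₄ ^ 14 - 132 * x₄ ^ 15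

/-- The printed polynomial `R₂(w)` of the `j`-map (js3s5), homogenised: `x₄¹³ · R₂(x₃/x₄)`.
[cite: FreitasLeHungSiksek2015, §5.3, eqn (js3s5) (arXiv:1310.7088 p. 27)] -/
def s3s5R₂ (x₃ x₄ : R) : R :=
  x₃ ^ 13 - 8 * x₃ ^ 12 * x₄ + 25 * x₃ ^ 11 * x₄ ^ 2 - 35 * x₃ ^ 10 * x₄ ^ 3
    + 5 * x₃ ^ 9 * x₄ ^ 4 + 94 * x₃ ^ 8 * x₄ ^ 5 - 467 * x₃ ^ 7 * x₄ ^ 6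
    + 1805 * x₃ ^ 6 * x₄ ^ 7 - 5175 * x₃ ^ 5 * x₄ ^ 8 + 9685 * x₃ ^ 4 * x₄ ^ 9
    - 11216 * x₃ ^ 3 * x₄ ^ 10 + 7698 * x₃ ^ 2 * x₄ ^ 11 - 2715 * x₃ * x₄ ^ 12 + 315 * x₄ ^ 13

/-- Numerator of the printed `j`-map in the projective coordinates of the canonical model:
`(R₁ʰ(x₃,x₄) + R₂ʰ(x₃,x₄)·x₂x₃)³ = x₄⁴⁵ · (R₁(w) + R₂(w) v)³` (`v = x₂x₃/x₄²`, `w = x₃/x₄`).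
[cite: FreitasLeHungSiksek2015, §5.3, eqn (js3s5) (arXiv:1310.7088 p. 27)] -/
def s3s5JNum (x₂ x₃ x₄ : R) : R :=
  (s3s5R₁ x₃ x₄ + s3s5R₂ x₃ x₄ * x₂ * x₃) ^ 3

/-- Denominator of the printed `j`-map in projective coordinates:
`8 x₄¹⁵ (x₃² − x₃x₄ − x₄²)¹⁵ = x₄⁴⁵ · 8 R₃(w)¹⁵`, `R₃ = w² − w − 1`.
[cite: FreitasLeHungSiksek2015, §5.3, eqn (js3s5) (arXiv:1310.7088 p. 27)] -/
def s3s5JDen (x₃ x₄ : R) : R :=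
  8 * x₄ ^ 15 * (x₃ ^ 2 - x₃ * x₄ - x₄ ^ 2) ^ 15

end Model

section ModelChecks

variable {R : Type*} [CommRing R]

/-- The four rational points `(±1 : ±1 : 1 : 0)` over `w = ∞` lie on the canonical model.
[cite: FreitasLeHungSiksek2015, §5.3 (arXiv:1310.7088 p. 26)] -/
theorem s3s5_point_at_infinity (ε₁ ε₂ : R) (h₁ : ε₁ ^ 2 = 1) (h₂ : ε₂ ^ 2 = 1) :
    s3s5Quadric ε₁ ε₂ 1 0 = 0 ∧ s3s5Cubic ε₁ ε₂ 1 0 = 0 := by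
  constructor
  · unfold s3s5Quadric; linear_combination 3 * h₁ - h₂
  · unfold s3s5Cubic; linear_combination h₂

/-- The eight points over `w² = w + 1` (the source's case (a): `w = (1 ± √5)/2`, `u = ±√5`,
`v = ±(5 ∓ √5)/2`), written projectively as `(u : v : w² : w) = (±2r : ±(5 − r) : 3 + r : 1 + r)`
after clearing `2`, with `r² = 5` (`r = √5` gives `w = (1+√5)/2`, `r = −√5` its conjugate), lie on
the canonical model. [cite: FreitasLeHungSiksek2015, §5.3, case (a) (arXiv:1310.7088 p. 26)] -/
theorem s3s5_point_over_golden (r ε₁ ε₂ : R) (hr : r ^ 2 = 5) (h₁ : ε₁ ^ 2 = 1)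
    (h₂ : ε₂ ^ 2 = 1) :
    s3s5Quadric (ε₁ * (2 * r)) (ε₂ * (5 - r)) (3 + r) (1 + r) = 0 ∧
      s3s5Cubic (ε₁ * (2 * r)) (ε₂ * (5 - r)) (3 + r) (1 + r) = 0 := by
  constructor
  · unfold s3s5Quadric
    linear_combination (12 * r ^ 2) * h₁ - (5 - r) ^ 2 * h₂ + 8 * hr
  · unfold s3s5Cubic
    linear_combination (5 - r) ^ 2 * (3 + r) * h₂ + (4 * r - 12) * hr

/-- On the locus `x₃ = x₄ = 0` the model reduces to `3x₁² = x₂²`: the two points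
`(1 : ±√3 : 0 : 0)` (the place of degree `2` over the node `w = 0` of the affine model (s3s5)).
[cite: FreitasLeHungSiksek2015, §5.3 (arXiv:1310.7088 p. 26)] -/
theorem s3s5Quadric_eq_zero_of_x₃_x₄ (x₁ x₂ : R) :
    (s3s5Quadric x₁ x₂ 0 0 = 0 ↔ 3 * x₁ ^ 2 = x₂ ^ 2) ∧ s3s5Cubic x₁ x₂ 0 0 = 0 := by
  refine ⟨?_, by simp [s3s5Cubic]⟩
  simp only [s3s5Quadric]
  constructor <;> intro h <;> linear_combination h

/-- At `x₄ = 0`, `x₃ = 1` the printed numerator is `(1 + x₂)³`: it vanishes at the two points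
`(±1 : −1 : 1 : 0)` (where the `j`-map is regular with value `−2¹⁵`, CM points) and equals `8` at
the two cusps `(±1 : 1 : 1 : 0)`. [cite: FreitasLeHungSiksek2015, §5.3, eqn (js3s5) (arXiv:1310.7088 p. 27)] -/
theorem s3s5JNum_infinity (x₂ : R) : s3s5JNum x₂ 1 0 = (1 + x₂) ^ 3 := by
  simp [s3s5JNum, s3s5R₁, s3s5R₂]

/-- Value of the printed numerator polynomial `R₁` at `w = 0` (`x₃ = 0`, `x₄ = 1`): `−132`, so
that `j = R₁(0)³ / (8 R₃(0)¹⁵) = (−132)³/(−8) = 66³ = 287496` over the node `w = 0`.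
[cite: FreitasLeHungSiksek2015, §5.3, eqn (js3s5) (arXiv:1310.7088 p. 27)] -/
theorem s3s5JNum_node : s3s5JNum (0 : R) 0 1 = (-132) ^ 3 ∧ s3s5JDen (0 : R) 1 = -8 ∧
    ((-132 : ℤ) ^ 3 = 287496 * (-8)) := by
  refine ⟨by simp [s3s5JNum, s3s5R₁, s3s5R₂], by norm_num [s3s5JDen], by norm_num⟩

/-- Where the printed denominator vanishes (over a domain): `x₄ = 0` or `x₃² − x₃x₄ − x₄² = 0`
(`w = ∞` or `w² = w + 1`). [cite: FreitasLeHungSiksek2015, §5.3, eqn (js3s5) (arXiv:1310.7088 p. 27)] -/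
theorem s3s5JDen_eq_zero_iff [IsDomain R] [NeZero (2 : R)] (x₃ x₄ : R) :
    s3s5JDen x₃ x₄ = 0 ↔ x₄ * (x₃ ^ 2 - x₃ * x₄ - x₄ ^ 2) = 0 := by
  have h8 : (8 : R) ≠ 0 := by
    have h2 : (2 : R) ≠ 0 := NeZero.ne 2
    have : (8 : R) = 2 * 2 * 2 := by norm_num
    rw [this]; exact mul_ne_zero (mul_ne_zero h2 h2) h2
  simp [s3s5JDen, h8, mul_eq_zero, pow_eq_zero_iff]

end ModelChecks

/-! ### The named fact: moduli interpretation of `X(s3,s5)` with the printed `j`-map -/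

/-- **Freitas–Le Hung–Siksek 2015, §2.2 + §5.3: an elliptic curve with split-Cartan-normaliser
level structure at `3` and at `5` gives a point of the canonical model of
`X(s3,s5) ≅ X₀(225)/⟨w₉,w₂₅⟩` whose printed `j`-value is `j(E)`.**  For every number field `K`
and `E / 𝓞 K` with `Δ(E) ≠ 0` such that some framing `ρ̄₃` of `(E ⊗ K)[3]` has image in the
normaliser of a split Cartan subgroup `P₃ (* 0; 0 *) P₃⁻¹ ≤ GL₂(𝔽₃)` and some framing `ρ̄₅` of
`(E ⊗ K)[5]` has image in the normaliser of a split Cartan subgroup of `GL₂(𝔽₅)` (§2.2: "non-cuspidal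
`K`-points correspond to … `E/K` … such that `η⁻¹ ρ̄_{E,pᵢ}(G_K) η` is contained in `Hᵢ`", here
`H = C_s⁺(3), C_s⁺(5)`, both containing `−I` with surjective determinant), there is a point
`x = (x₁ : x₂ : x₃ : x₄) ≠ 0` of `K⁴` on the printed canonical model (`s3s5Quadric = 0`,
`s3s5Cubic = 0`, §5.3 p. 26) at which the printed `j`-map (js3s5) takes the value
`j(E) = c₄(E)³/Δ(E)`, division-free: `c₄³ · s3s5JDen(x₃,x₄) = s3s5JNum(x₂,x₃,x₄) · Δ`; and at the
fourteen points of the model where `s3s5JDen` vanishes (so that the relation reads `0 = 0`) the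
value of the regular extension of the printed map at the eight non-cuspidal ones is recorded
explicitly: `j = 66³ = 287496` if `x₃ = x₄ = 0` (the two points `(1 : ±√3 : 0 : 0)` over the node
`w = 0`, `j = R₁(0)³/(8R₃(0)¹⁵)`), and `j = −2¹⁵ = −32768` otherwise (the points `(±1 : −1 : 1 : 0)`
and the four points over `w² = w + 1` with `v = +(5 − r)/2`, `r = 2w − 1`; CM by
`ℤ[(1+√−11)/2]`) — these two values are the exact evaluation of the printed rational function
(power series to order `5` along `v² = h₂(w)`, three independent computations in cell
`pub/lg-quartmod`: eng-9 kit j313249, eng-3 E9-RESULT §1(c), typ-1 scratch/check2.py); the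
remaining six points with `s3s5JDen = 0` are the cusps (the source, p. 26: the points of case (a)
"are cusps" — true for the four with `v = −(5 − r)/2`).  WEAKER than print in that nothing is said
about which points are cusps; a named fact (D-0014): users take
`(h : FLS2015.s3s5_jRelation_of_isTorsionGaloisRep)`.
[cite: FreitasLeHungSiksek2015, §2.2 (arXiv:1310.7088 p. 9) and §5.3, proof of the Lemma on X(s3,s5): canonical model, (s3s5), (js3s5) (pp. 26–27)] -/
def s3s5_jRelation_of_isTorsionGaloisRep : Prop :=
  ∀ (K : Type) [Field K] [NumberField K] (E : WeierstrassCurve (𝓞 K)), E.Δ ≠ 0 →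
    (∃ ρ : FramedGaloisRep K (ZMod 3) 2, (E.baseChange K).IsTorsionGaloisRep 3 ρ ∧
      ∃ P : GL (Fin 2) (ZMod 3), ∀ σ : absoluteGaloisGroup K,
        ρ σ ∈ Subgroup.normalizer (Serre1972.splitCartan P : Set (GL (Fin 2) (ZMod 3)))) →
    (∃ ρ : FramedGaloisRep K (ZMod 5) 2, (E.baseChange K).IsTorsionGaloisRep 5 ρ ∧
      ∃ P : GL (Fin 2) (ZMod 5), ∀ σ : absoluteGaloisGroup K,
        ρ σ ∈ Subgroup.normalizer (Serre1972.splitCartan P : Set (GL (Fin 2) (ZMod 5)))) →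
    ∃ x₁ x₂ x₃ x₄ : K, (x₁ ≠ 0 ∨ x₂ ≠ 0 ∨ x₃ ≠ 0 ∨ x₄ ≠ 0) ∧
      s3s5Quadric x₁ x₂ x₃ x₄ = 0 ∧ s3s5Cubic x₁ x₂ x₃ x₄ = 0 ∧
      (E.baseChange K).c₄ ^ 3 * s3s5JDen x₃ x₄ = s3s5JNum x₂ x₃ x₄ * (E.baseChange K).Δ ∧
      (x₃ = 0 → x₄ = 0 → (E.baseChange K).c₄ ^ 3 = 287496 * (E.baseChange K).Δ) ∧
      ((x₃ ≠ 0 ∨ x₄ ≠ 0) → x₄ * (x₃ ^ 2 - x₃ * x₄ - x₄ ^ 2) = 0 →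
        (E.baseChange K).c₄ ^ 3 = -32768 * (E.baseChange K).Δ)

end FLS2015

end Literature.NumberTheory.Automorphic

end
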